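import Mathlib.MeasureTheory.Constructions.HaarToSphere
import Literature.Analysis.FluidPDE.AxisymmetricVorticityTransport
import Literature.Analysis.FluidPDE.MeridianReduction
import HarnessLib

/-!
# Cylindrical integration on `ℝ³`: Fubini over `(z, x_h)` and radial reduction for axisymmetric
# integrands

Analysis/FluidPDE support file (all results proved) for the decomposition of KNSS 2009,
Theorem 5.3 (`KNSSSwirlLiouville`): the cut-off argument of Koch–Nadirashvili–Seregin–Šverák,
Acta Math. 203 (2009) = arXiv:0709.3599, p. 10, integrates axisymmetric quantities over
`ℝ³ × (t₁, t₂)` in cylindrical coordinates, `dx = r dr dθ dz` ((5.19):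
`−∫ (2/r) f_{,r} φ dx dt = −4π ∫∫∫ f_{,r} φ dr dz dt`), and integrates by parts in `r` using
that `f` vanishes on the axis. This file provides that calculus on
`ℝ³ = EuclideanSpace ℝ (Fin 3)`:

* `cylSplit : ℝ³ ≃ᵐ ℝ × ℝ²`, `x ↦ (x₂, (x₀, x₁))`, a volume-preserving measurable equivalence
  (`measurePreserving_cylSplit`), with `cylRadius (cylSplit.symm (z, w)) = ‖w‖`;
* Fubini in these variables (`integral_eq_integral_integral_cylSplit`);
* the radial reduction on horizontal slices for axisymmetric scalars
  (`IsAxisymmetricScalar.integral_eq`): `∫ G = ∫ dz, c₂ ∫₀^∞ ρ G(ρ, 0, z) dρ` with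
  `c₂ = 2 |B₁(ℝ²)| = 2π` (Mathlib's `integral_fun_norm_addHaar`, the value of `c₂` is not used),
  the points `(ρ, 0, z)` being the `meridianPoint (ρ, z)` of `MeridianReduction`;
* separation of variables `∫ h(r) g(x₂) dx = (∫ g) · c₂ ∫₀^∞ ρ h(ρ) dρ` with integrability
  (`integrable_and_integral_fun_cylRadius_mul`), local integrability of `1/r`
  (`integrableOn_inv_cylRadius_solidCylinder`) and the volume of the cylinder boxes
  `{r ≤ a, |z| ≤ b}`, linear in `b` (`volume_solidCylinder`);
* **the axis integration by parts** (`integral_two_div_cylRadius_mul_fderiv_eR`, with the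
  integrability of both integrands, `integrable_and_integral_two_div_cylRadius_mul_fderiv_eR`): for
  axisymmetric `C¹` scalars `F`, `φ` with `φ` compactly supported and `F = 0` on the axis,
  `∫ (2/r) ∂ᵣF φ dx = −∫ (2/r) F ∂ᵣφ dx` ("The key point then is that `f^λ` vanishes at the
  `x₃`-axis", KNSS p. 10, (5.19)–(5.20)).

## References

* G. Koch, N. Nadirashvili, G. Seregin, V. Šverák, *Liouville theorems for the Navier–Stokes
  equations and applications*, Acta Math. 203 (2009) = arXiv:0709.3599, proof of Theorem 5.3,
  (5.15)–(5.20), p. 10. [KochNadirashviliSereginSverak2009]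
-/

noncomputable section

open MeasureTheory Set Function Filter Topology TopologicalSpace WithLp Metric
open scoped RealInnerProductSpace ENNReal

namespace Literature.Analysis.FluidPDE

/-- Local notation for physical space `ℝ³ = EuclideanSpace ℝ (Fin 3)`. -/
local notation "ℝ³" => EuclideanSpace ℝ (Fin 3)

/-- Local notation for the horizontal plane `ℝ² = EuclideanSpace ℝ (Fin 2)`. -/
local notation "ℝ²" => EuclideanSpace ℝ (Fin 2)

/-! ### The cylindrical splitting `ℝ³ ≃ ℝ × ℝ²` -/

/-- The measurable equivalence `ℝ³ ≃ᵐ ℝ × ℝ²`, `x ↦ (x₂, (x₀, x₁))` (axial coordinate and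
horizontal projection), through Mathlib's `MeasurableEquiv.piFinSuccAbove` at the index `2`.
[folklore] -/
def cylSplit : ℝ³ ≃ᵐ ℝ × ℝ² :=
  ((MeasurableEquiv.toLp 2 (Fin 3 → ℝ)).symm.trans
    (MeasurableEquiv.piFinSuccAbove (fun _ => ℝ) 2)).trans
    (MeasurableEquiv.prodCongr (MeasurableEquiv.refl ℝ) (MeasurableEquiv.toLp 2 (Fin 2 → ℝ)))

/-- The first component of `cylSplit x` is the axial coordinate `x₂`. [folklore] -/
@[simp] theorem cylSplit_apply_fst (x : ℝ³) : (cylSplit x).1 = x 2 := rfl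

/-- The horizontal component of `cylSplit x` has coordinates `(x₀, x₁)`. [folklore] -/
@[simp] theorem cylSplit_apply_snd_apply (x : ℝ³) (j : Fin 2) :
    (cylSplit x).2 j = x (Fin.succAbove 2 j) := rfl

/-- The forward map on a vector written in coordinates: `cylSplit (w₀, w₁, z) = (z, w)`.
[folklore] -/
theorem cylSplit_toLp (z : ℝ) (w : ℝ²) : cylSplit (toLp 2 ![w 0, w 1, z]) = (z, w) := by
  refine Prod.ext rfl ?_
  ext j
  fin_cases j <;> rfl

/-- The inverse: `cylSplit.symm (z, w) = (w₀, w₁, z)`. [folklore] -/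
theorem cylSplit_symm_apply (z : ℝ) (w : ℝ²) :
    cylSplit.symm (z, w) = toLp 2 ![w 0, w 1, z] := by
  apply cylSplit.injective
  rw [MeasurableEquiv.apply_symm_apply, cylSplit_toLp]

/-- The axial coordinate of `cylSplit.symm (z, w)` is `z`. [folklore] -/
@[simp] theorem cylSplit_symm_apply_two (z : ℝ) (w : ℝ²) : cylSplit.symm (z, w) 2 = z := by
  rw [cylSplit_symm_apply]; rfl

/-- The first horizontal coordinate of `cylSplit.symm (z, w)` is `w₀`. [folklore] -/
@[simp] theorem cylSplit_symm_apply_zero (z : ℝ) (w : ℝ²) : cylSplit.symm (z, w) 0 = w 0 := by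
  rw [cylSplit_symm_apply]; rfl

/-- The second horizontal coordinate of `cylSplit.symm (z, w)` is `w₁`. [folklore] -/
@[simp] theorem cylSplit_symm_apply_one (z : ℝ) (w : ℝ²) : cylSplit.symm (z, w) 1 = w 1 := by
  rw [cylSplit_symm_apply]; rfl

/-- The cylindrical radius in the split variables is the norm of the horizontal component:
`r (w₀, w₁, z) = ‖w‖`. [folklore] -/
@[simp] theorem cylRadius_cylSplit_symm (z : ℝ) (w : ℝ²) :
    cylRadius (cylSplit.symm (z, w)) = ‖w‖ := by
  rw [cylRadius, EuclideanSpace.norm_eq, Fin.sum_univ_two]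
  simp [Real.norm_eq_abs, sq_abs]

/-- `cylSplit` preserves Lebesgue measure (it is a coordinate permutation composed with the
volume-preserving identifications `EuclideanSpace ℝ (Fin n) ≃ (Fin n → ℝ)`). [folklore] -/
theorem measurePreserving_cylSplit : MeasurePreserving cylSplit volume volume := by
  have h1 : MeasurePreserving (MeasurableEquiv.toLp 2 (Fin 3 → ℝ)).symm volume volume :=
    EuclideanSpace.volume_preserving_symm_measurableEquiv_toLp (Fin 3)
  have h2 : MeasurePreserving (MeasurableEquiv.piFinSuccAbove (fun _ : Fin 3 => ℝ) 2) volume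
      volume :=
    volume_preserving_piFinSuccAbove (fun _ => ℝ) 2
  have h3 : MeasurePreserving
      (MeasurableEquiv.prodCongr (MeasurableEquiv.refl ℝ) (MeasurableEquiv.toLp 2 (Fin 2 → ℝ)))
      volume volume :=
    (MeasurePreserving.id volume).prod (PiLp.volume_preserving_toLp (Fin 2))
  exact (h1.trans h2).trans h3

/-- `cylSplit.symm` preserves Lebesgue measure. [folklore] -/
theorem measurePreserving_cylSplit_symm : MeasurePreserving cylSplit.symm volume volume :=
  measurePreserving_cylSplit.symm _

/-! ### Fubini in the variables `(z, w)` -/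

section Fubini

variable {F : Type*} [NormedAddCommGroup F] [NormedSpace ℝ F]

/-- Change of variables: `∫ G dx = ∫ G (w₀, w₁, z) d(z, w)`. [folklore] -/
theorem integral_eq_integral_cylSplit (G : ℝ³ → F) :
    ∫ x, G x = ∫ p : ℝ × ℝ², G (cylSplit.symm p) :=
  (measurePreserving_cylSplit_symm.integral_comp cylSplit.symm.measurableEmbedding G).symm

omit [NormedSpace ℝ F] in
/-- Integrability transfers along `cylSplit.symm`. [folklore] -/
theorem integrable_comp_cylSplit_symm_iff {G : ℝ³ → F} :
    Integrable (fun p : ℝ × ℝ² => G (cylSplit.symm p)) ↔ Integrable G :=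
  measurePreserving_cylSplit_symm.integrable_comp_emb cylSplit.symm.measurableEmbedding

/-- **Fubini in cylindrical variables**: `∫ G dx = ∫ dz ∫ dw G (w₀, w₁, z)` for integrable `G`.
[folklore] -/
theorem integral_eq_integral_integral_cylSplit {G : ℝ³ → F} (hG : Integrable G) :
    ∫ x, G x = ∫ z : ℝ, ∫ w : ℝ², G (cylSplit.symm (z, w)) := by
  rw [integral_eq_integral_cylSplit]
  exact integral_prod _ (integrable_comp_cylSplit_symm_iff.2 hG)

end Fubini

/-! ### Radial reduction on horizontal slices for axisymmetric scalars -/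

/-- The constant `c₂ = 2 |B₁(ℝ²)| (= 2π)` of the planar radial integration formula
`∫_{ℝ²} h(‖w‖) dw = c₂ ∫₀^∞ ρ h(ρ) dρ`. [folklore] -/
def radialConst₂ : ℝ := 2 * (volume : Measure ℝ²).real (ball 0 1)

/-- `c₂ > 0`. [folklore] -/
theorem radialConst₂_pos : 0 < radialConst₂ := by
  have h : 0 < (volume : Measure ℝ²).real (ball 0 1) :=
    ENNReal.toReal_pos (measure_ball_pos volume (0 : ℝ²) one_pos).ne'
      measure_ball_lt_top.ne
  unfold radialConst₂
  positivity

section Radial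

variable {F : Type*} [NormedAddCommGroup F] [NormedSpace ℝ F]

/-- **Planar radial integration**: `∫_{ℝ²} h(‖w‖) dw = c₂ ∫₀^∞ ρ h(ρ) dρ` (Mathlib
`integral_fun_norm_addHaar` in dimension `2`). [folklore] -/
theorem integral_fun_norm_two (h : ℝ → F) :
    ∫ w : ℝ², h ‖w‖ = radialConst₂ • ∫ ρ in Ioi (0 : ℝ), ρ • h ρ := by
  rw [integral_fun_norm_addHaar volume h, finrank_euclideanSpace, Fintype.card_fin,
    radialConst₂, mul_smul]
  simp only [Nat.add_one_sub_one, pow_one, ← Nat.cast_smul_eq_nsmul ℝ, Nat.cast_ofNat]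

/-- `r (ρ, 0, z) = |ρ|` for the meridian point `meridianPoint (ρ, z) = (ρ, 0, z)` of
`MeridianReduction`. [folklore] -/
theorem cylRadius_meridianPoint_eq_abs (ρ z : ℝ) : cylRadius (meridianPoint (ρ, z)) = |ρ| := by
  rw [cylRadius, meridianPoint_apply_zero, meridianPoint_apply_one]
  simp [Real.sqrt_sq_eq_abs]

/-- An axisymmetric scalar depends on `(r, z)` only: `G (w₀, w₁, z) = G (‖w‖, 0, z)`
(`IsAxisymmetricScalar.eq_comp_meridian` in the split variables). [folklore] -/
theorem IsAxisymmetricScalar.apply_cylSplit_symm {α : Sort*} {G : ℝ³ → α}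
    (hG : IsAxisymmetricScalar G) (z : ℝ) (w : ℝ²) :
    G (cylSplit.symm (z, w)) = G (meridianPoint (‖w‖, z)) := by
  rw [hG.eq_comp_meridian (cylSplit.symm (z, w)), meridian_apply, cylRadius_cylSplit_symm,
    cylSplit_symm_apply_two]

/-- **Radial reduction for axisymmetric scalars.** If `G : ℝ³ → F` is an axisymmetric scalar,
then on every horizontal slice `∫ G(w₀, w₁, z) dw = c₂ ∫₀^∞ ρ G(ρ, 0, z) dρ`, and hence (Fubini)
`∫ G dx = ∫ dz c₂ ∫₀^∞ ρ G(ρ, 0, z) dρ` for integrable `G`: the formula `dx = r dr dθ dz` for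
integrands not depending on `θ` (KNSS 2009, (5.19)). [cite: KochNadirashviliSereginSverak2009, proof of Thm 5.3, (5.19) (arXiv p. 10)] -/
theorem IsAxisymmetricScalar.integral_slice_eq {G : ℝ³ → F} (hG : IsAxisymmetricScalar G)
    (z : ℝ) : ∫ w : ℝ², G (cylSplit.symm (z, w)) =
      radialConst₂ • ∫ ρ in Ioi (0 : ℝ), ρ • G (meridianPoint (ρ, z)) := by
  simp_rw [hG.apply_cylSplit_symm z]
  exact integral_fun_norm_two fun ρ => G (meridianPoint (ρ, z))

/-- `∫ G dx = ∫ dz c₂ ∫₀^∞ ρ G(ρ, 0, z) dρ` for an integrable axisymmetric scalar `G`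
(KNSS 2009, (5.19): `dx = r dr dθ dz`). [cite: KochNadirashviliSereginSverak2009, proof of Thm 5.3, (5.19) (arXiv p. 10)] -/
theorem IsAxisymmetricScalar.integral_eq {G : ℝ³ → F} (hG : IsAxisymmetricScalar G)
    (hGi : Integrable G) :
    ∫ x, G x = ∫ z : ℝ, radialConst₂ • ∫ ρ in Ioi (0 : ℝ), ρ • G (meridianPoint (ρ, z)) := by
  rw [integral_eq_integral_integral_cylSplit hGi]
  exact integral_congr_ae (Eventually.of_forall fun z => hG.integral_slice_eq z)

/-- **Separation of variables in cylindrical coordinates.** For `h, g : ℝ → ℝ` with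
`ρ ↦ ρ h(ρ)` integrable on `(0, ∞)` and `g` integrable, the function `x ↦ h(r) g(x₂)` is
integrable on `ℝ³` and `∫ h(r(x)) g(x₂) dx = (∫ g) · c₂ ∫₀^∞ ρ h(ρ) dρ` (`dx = r dr dθ dz`; this
evaluates the volumes of cylinder boxes, the integrals of `1/r` over them, and the cut-off
integrals `∫ (2/r) ξ'(r) η(z) dx` of KNSS 2009, (5.18)–(5.20)). [cite: KochNadirashviliSereginSverak2009, proof of Thm 5.3, (5.18)–(5.20) (arXiv p. 10)] -/
theorem integrable_and_integral_fun_cylRadius_mul {h g : ℝ → ℝ}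
    (hh : IntegrableOn (fun ρ => ρ * h ρ) (Ioi 0)) (hg : Integrable g) :
    Integrable (fun x : ℝ³ => h (cylRadius x) * g (x 2)) ∧
      ∫ x : ℝ³, h (cylRadius x) * g (x 2) =
        (∫ z, g z) * (radialConst₂ * ∫ ρ in Ioi (0 : ℝ), ρ * h ρ) := by
  -- integrability through the product structure
  have hw : Integrable (fun w : ℝ² => h ‖w‖) := by
    rw [integrable_fun_norm_addHaar volume (f := h), finrank_euclideanSpace, Fintype.card_fin]
    simpa only [Nat.add_one_sub_one, pow_one, smul_eq_mul] using hh
  have hprod : Integrable (fun p : ℝ × ℝ² => g p.1 * h ‖p.2‖) := hg.mul_prod hw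
  have hGi : Integrable (fun x : ℝ³ => h (cylRadius x) * g (x 2)) := by
    rw [← integrable_comp_cylSplit_symm_iff]
    refine hprod.congr (Eventually.of_forall fun p => ?_)
    obtain ⟨z, w⟩ := p
    simp only [cylRadius_cylSplit_symm, cylSplit_symm_apply_two, mul_comm]
  refine ⟨hGi, ?_⟩
  have haxi : IsAxisymmetricScalar fun x : ℝ³ => h (cylRadius x) * g (x 2) := fun θ x => by
    simp only [cylRadius_rotZ, rotZ_apply_two]
  rw [haxi.integral_eq hGi]
  have hslice : ∀ z : ℝ, (∫ ρ in Ioi (0 : ℝ), ρ • (h (cylRadius (meridianPoint (ρ, z))) * g z)) =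
      (∫ ρ in Ioi (0 : ℝ), ρ * h ρ) * g z := by
    intro z
    rw [← integral_mul_const]
    refine setIntegral_congr_fun measurableSet_Ioi fun ρ hρ => ?_
    simp only [cylRadius_meridianPoint_eq_abs, abs_of_pos (show (0 : ℝ) < ρ from hρ), smul_eq_mul]
    ring
  simp_rw [meridianPoint_apply_two, hslice, smul_eq_mul, ← mul_assoc, integral_const_mul]
  ring

end Radial

/-! ### Cylinder boxes: volume, and local integrability of `1/r` -/

section Boxes

/-- The closed solid cylinder `{r ≤ a, |z| ≤ b}` about the axis. [folklore] -/
def solidCylinder (a b : ℝ) : Set ℝ³ := {x | cylRadius x ≤ a ∧ |x 2| ≤ b}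

/-- The cylindrical radius is the norm of the horizontal component of `cylSplit`. [folklore] -/
theorem cylRadius_eq_norm_cylSplit_snd (x : ℝ³) : cylRadius x = ‖(cylSplit x).2‖ := by
  conv_lhs => rw [← cylSplit.symm_apply_apply x]
  rw [show cylSplit x = ((cylSplit x).1, (cylSplit x).2) from rfl, cylRadius_cylSplit_symm]

/-- The cylinder box in the split variables is the product `[-b, b] × B̄(0, a)`. [folklore] -/
theorem solidCylinder_eq_preimage (a b : ℝ) :
    solidCylinder a b = cylSplit ⁻¹' (Icc (-b) b ×ˢ closedBall (0 : ℝ²) a) := by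
  ext x
  simp only [solidCylinder, mem_setOf_eq, mem_preimage, mem_prod, mem_Icc, mem_closedBall,
    dist_zero_right, cylSplit_apply_fst, abs_le, cylRadius_eq_norm_cylSplit_snd]
  tauto

/-- Cylinder boxes are measurable (closed). [folklore] -/
theorem measurableSet_solidCylinder (a b : ℝ) : MeasurableSet (solidCylinder a b) := by
  rw [solidCylinder_eq_preimage]
  exact cylSplit.measurable (measurableSet_Icc.prod measurableSet_closedBall)

/-- A bounded set lies in a cylinder box: `B̄(0, R) ⊆ {r ≤ R, |z| ≤ R}`. [folklore] -/
theorem closedBall_subset_solidCylinder (R : ℝ) : closedBall (0 : ℝ³) R ⊆ solidCylinder R R := by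
  intro x hx
  rw [mem_closedBall, dist_zero_right] at hx
  have h2 : |x 2| ≤ ‖x‖ := by
    have := PiLp.norm_apply_le x 2
    rwa [Real.norm_eq_abs] at this
  have hr : cylRadius x ≤ ‖x‖ := by
    rw [cylRadius, EuclideanSpace.norm_eq, Fin.sum_univ_three]
    apply Real.sqrt_le_sqrt
    simp only [Real.norm_eq_abs, sq_abs]
    nlinarith [sq_nonneg (x 2)]
  exact ⟨hr.trans hx, h2.trans hx⟩

/-- **Volume of a cylinder box**: `|{r ≤ a, |z| ≤ b}| = 2b · |B̄₁(ℝ²) a|`, linear in the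
height (KNSS 2009, p. 10: the bound `|I| ≤ C L δ²`). [folklore] -/
theorem volume_solidCylinder (a b : ℝ) :
    volume (solidCylinder a b) = ENNReal.ofReal (2 * b) * volume (closedBall (0 : ℝ²) a) := by
  rw [solidCylinder_eq_preimage, measurePreserving_cylSplit.measure_preimage
    (measurableSet_Icc.prod measurableSet_closedBall).nullMeasurableSet,
    Measure.volume_eq_prod, Measure.prod_prod, Real.volume_Icc]
  congr 2
  ring

/-- Cylinder boxes have finite volume. [folklore] -/
theorem volume_solidCylinder_lt_top (a b : ℝ) : volume (solidCylinder a b) < ∞ := by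
  rw [volume_solidCylinder]
  exact ENNReal.mul_lt_top ENNReal.ofReal_lt_top measure_closedBall_lt_top

/-- `w ↦ ‖w‖⁻¹` is integrable on bounded balls of the plane (`ρ · ρ⁻¹ = 1` on `(0, a)`;
Mathlib `integrableOn_fun_norm_addHaar`). [folklore] -/
theorem integrableOn_inv_norm_ball_two (a : ℝ) :
    IntegrableOn (fun w : ℝ² => ‖w‖⁻¹) (ball (0 : ℝ²) a) := by
  rw [integrableOn_fun_norm_addHaar volume (f := fun y : ℝ => y⁻¹), finrank_euclideanSpace,
    Fintype.card_fin]
  simp only [Nat.add_one_sub_one, pow_one, smul_eq_mul]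
  refine (integrableOn_const (C := (1 : ℝ))
    (show volume (Ioo (0 : ℝ) a) ≠ ∞ from measure_Ioo_lt_top.ne)).congr_fun
    (fun y hy => ?_) measurableSet_Ioo
  exact (mul_inv_cancel₀ hy.1.ne').symm

/-- **`1/r` is locally integrable in `ℝ³`**: it is integrable on every cylinder box (Fubini in
`(z, w)` and the planar computation `∫_{|w| ≤ a} |w|⁻¹ dw = c₂ a < ∞`; KNSS 2009, p. 10: the
bound `|II| ≤ C δ T₁` integrates `|u| ≤ C/r` near the axis). [folklore] -/
theorem integrableOn_inv_cylRadius_solidCylinder (a b : ℝ) :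
    IntegrableOn (fun x : ℝ³ => (cylRadius x)⁻¹) (solidCylinder a b) := by
  -- the product function on `ℝ × ℝ²`
  have hprod : Integrable (fun p : ℝ × ℝ² =>
      (Icc (-b) b).indicator (fun _ => (1 : ℝ)) p.1 *
        (ball (0 : ℝ²) (|a| + 1)).indicator (fun w => ‖w‖⁻¹) p.2) := by
    refine Integrable.mul_prod ?_ ?_
    · exact (integrableOn_const (C := (1 : ℝ)) (by exact measure_Icc_lt_top.ne)).integrable_indicator
        measurableSet_Icc
    · exact (integrableOn_inv_norm_ball_two (|a| + 1)).integrable_indicator measurableSet_ball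
  -- it dominates the transported integrand
  refine (integrable_indicator_iff (measurableSet_solidCylinder a b)).1 ?_
  rw [← integrable_comp_cylSplit_symm_iff]
  refine hprod.mono' ?_ (Eventually.of_forall fun p => ?_)
  · refine (Measurable.indicator ?_ (measurableSet_solidCylinder a b)).aestronglyMeasurable.comp_measurable
      cylSplit.symm.measurable
    exact continuous_cylRadius.measurable.inv
  · obtain ⟨z, w⟩ := p
    simp only [indicator, mem_Icc, mem_ball, dist_zero_right, solidCylinder, mem_setOf_eq,
      cylRadius_cylSplit_symm, cylSplit_symm_apply_two, abs_le]
    by_cases h : ‖w‖ ≤ a ∧ -b ≤ z ∧ z ≤ b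
    · have hw : ‖w‖ < |a| + 1 := by linarith [h.1, le_abs_self a]
      rw [if_pos h, if_pos h.2, if_pos hw, one_mul, Real.norm_eq_abs, abs_inv, abs_norm]
    · rw [if_neg h, norm_zero]
      positivity

end Boxes

/-! ### The axis integration by parts -/

section AxisIBP

/-- The radial unit vector is equivariant under rotations about the axis (the tree's
`eR_rotZ` of `KatoLaiPeriodicCylinder`, restated privately to keep the imports light). [folklore] -/
private theorem eR_rotZ_aux (θ : ℝ) (x : ℝ³) : eR (rotZ θ x) = rotZ θ (eR x) := by
  rw [eR, eR, cylRadius_rotZ]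
  ext i
  fin_cases i <;> simp [rotZ] <;> ring

/-- **The radial derivative of an axisymmetric scalar is an axisymmetric scalar**:
`∂ᵣg (R_θ x) = ∂ᵣg (x)` (chain rule through `g ∘ R_θ = g` and `e_r (R_θ x) = R_θ e_r(x)`).
[folklore] -/
theorem IsAxisymmetricScalar.fderiv_apply_eR {g : ℝ³ → ℝ} (hg : IsAxisymmetricScalar g)
    (hd : Differentiable ℝ g) : IsAxisymmetricScalar fun x => fderiv ℝ g x (eR x) := by
  intro θ x
  have hcomp : (fun y => g (rotZL θ y)) = g := funext fun y => hg θ y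
  have hl : HasFDerivAt (fun y => g (rotZL θ y)) ((fderiv ℝ g (rotZ θ x)).comp (rotZL θ)) x :=
    (hd (rotZL θ x)).hasFDerivAt.comp x (rotZL θ).hasFDerivAt
  rw [hcomp] at hl
  have heq : fderiv ℝ g x = (fderiv ℝ g (rotZ θ x)).comp (rotZL θ) := hl.fderiv
  show fderiv ℝ g (rotZ θ x) (eR (rotZ θ x)) = fderiv ℝ g x (eR x)
  rw [eR_rotZ_aux, heq, ContinuousLinearMap.comp_apply, rotZL_apply]

/-- The meridian point depends affinely on `ρ`: `d/dρ (ρ, 0, z) = e₀`. [folklore] -/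
theorem hasDerivAt_meridianPoint_fst (ρ z : ℝ) :
    HasDerivAt (fun ρ => meridianPoint (ρ, z)) (EuclideanSpace.single 0 (1 : ℝ)) ρ := by
  have h : (fun ρ : ℝ => meridianPoint (ρ, z)) =
      fun ρ => ρ • EuclideanSpace.single 0 (1 : ℝ) + meridianPoint (0, z) := by
    funext ρ
    ext i
    fin_cases i <;> simp [meridianPoint]
  rw [h]
  simpa using ((hasDerivAt_id ρ).smul_const (EuclideanSpace.single 0 (1 : ℝ))).add_const
    (meridianPoint (0, z))

/-- On the meridian half-plane the radial unit vector is `e₀`: `e_r (ρ, 0, z) = e₀` for `ρ > 0`.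
[folklore] -/
theorem eR_meridianPoint {ρ : ℝ} (hρ : 0 < ρ) (z : ℝ) :
    eR (meridianPoint (ρ, z)) = EuclideanSpace.single 0 (1 : ℝ) := by
  rw [eR, cylRadius_meridianPoint_eq_abs, abs_of_pos hρ]
  ext i
  fin_cases i <;> simp [meridianPoint, hρ.ne']

/-- Chain rule along the meridian ray: `d/dρ g(ρ, 0, z) = Dg(ρ,0,z)[e₀]`. [folklore] -/
theorem hasDerivAt_comp_meridianPoint_fst {g : ℝ³ → ℝ} {ρ : ℝ} (z : ℝ)
    (hd : DifferentiableAt ℝ g (meridianPoint (ρ, z))) :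
    HasDerivAt (fun ρ => g (meridianPoint (ρ, z)))
      (fderiv ℝ g (meridianPoint (ρ, z)) (EuclideanSpace.single 0 (1 : ℝ))) ρ :=
  hd.hasFDerivAt.comp_hasDerivAt ρ (hasDerivAt_meridianPoint_fst ρ z)

/-- **Integration by parts in `r` against the weight `1/r`, using vanishing on the axis**
(KNSS 2009, proof of Theorem 5.3, (5.19)–(5.20), arXiv p. 10: "`−∫ (2/r) f_{,r} φ dx dt =
−4π ∫∫∫ f_{,r} φ dr dz dt` … The key point then is that `f` vanishes at the `x₃`-axis"). For
axisymmetric `C¹` scalars `F`, `φ` on `ℝ³` with `φ` compactly supported and `F = 0` on the axis,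
`∫ (2/r) ∂ᵣF φ dx = −∫ (2/r) F ∂ᵣφ dx`, where `∂ᵣ = D(·)[e_r]`. Proof: the sum of the two sides is
the integral of the axisymmetric scalar `(2/r) ∂ᵣ(Fφ)`, which by the radial reduction equals
`∫ dz c₂ ∫₀^∞ 2 ∂_ρ[(Fφ)(ρ,0,z)] dρ = ∫ dz c₂ · 2 (0 − (Fφ)(0,0,z)) = 0`. [cite: KochNadirashviliSereginSverak2009, proof of Thm 5.3, (5.19)–(5.20) (arXiv p. 10)] -/
theorem integrable_and_integral_two_div_cylRadius_mul_fderiv_eR {F φ : ℝ³ → ℝ}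
    (hF : ContDiff ℝ 1 F) (hφ : ContDiff ℝ 1 φ) (hφc : HasCompactSupport φ)
    (hFa : IsAxisymmetricScalar F) (hφa : IsAxisymmetricScalar φ)
    (hF0 : ∀ x, cylRadius x = 0 → F x = 0) :
    Integrable (fun x => 2 / cylRadius x * (fderiv ℝ F x (eR x) * φ x)) ∧
    Integrable (fun x => 2 / cylRadius x * (F x * fderiv ℝ φ x (eR x))) ∧
    ∫ x, 2 / cylRadius x * (fderiv ℝ F x (eR x) * φ x) =
      -∫ x, 2 / cylRadius x * (F x * fderiv ℝ φ x (eR x)) := by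
  have hFd : Differentiable ℝ F := hF.differentiable one_ne_zero
  have hφd : Differentiable ℝ φ := hφ.differentiable one_ne_zero
  -- a cylinder box containing the support of `φ`
  obtain ⟨R, hR⟩ : ∃ R : ℝ, tsupport φ ⊆ closedBall (0 : ℝ³) R :=
    (hφc.isCompact.isBounded).subset_closedBall 0
  have hK : tsupport φ ⊆ solidCylinder R R := hR.trans (closedBall_subset_solidCylinder R)
  -- uniform (nonnegative) bounds on the compact support
  obtain ⟨CF, hCF0, hCF⟩ : ∃ C, 0 ≤ C ∧ ∀ x ∈ tsupport φ, |F x| ≤ C := by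
    obtain ⟨C, hC⟩ := hφc.isCompact.exists_bound_of_continuousOn hF.continuous.continuousOn
    exact ⟨|C|, abs_nonneg C, fun x hx => by
      simpa [Real.norm_eq_abs] using (hC x hx).trans (le_abs_self C)⟩
  obtain ⟨CDF, hCDF0, hCDF⟩ : ∃ C, 0 ≤ C ∧ ∀ x ∈ tsupport φ, ‖fderiv ℝ F x‖ ≤ C := by
    obtain ⟨C, hC⟩ := hφc.isCompact.exists_bound_of_continuousOn
      (hF.continuous_fderiv one_ne_zero).continuousOn
    exact ⟨|C|, abs_nonneg C, fun x hx => (hC x hx).trans (le_abs_self C)⟩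
  obtain ⟨Cφ, hCφ0, hCφ⟩ : ∃ C, 0 ≤ C ∧ ∀ x, |φ x| ≤ C := by
    obtain ⟨C, hC⟩ := hφ.continuous.bounded_above_of_compact_support hφc
    exact ⟨|C|, abs_nonneg C, fun x => by
      simpa [Real.norm_eq_abs] using (hC x).trans (le_abs_self C)⟩
  obtain ⟨CDφ, hCDφ0, hCDφ⟩ : ∃ C, 0 ≤ C ∧ ∀ x, ‖fderiv ℝ φ x‖ ≤ C := by
    obtain ⟨C, hC⟩ := (hφ.continuous_fderiv one_ne_zero).bounded_above_of_compact_support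
      (hφc.fderiv (𝕜 := ℝ))
    exact ⟨|C|, abs_nonneg C, fun x => (hC x).trans (le_abs_self C)⟩
  have heR : ∀ x, ‖eR x‖ ≤ 1 := fun x => by
    by_cases hx : cylRadius x = 0
    · simp [eR, hx]
    · rw [eR, norm_smul, norm_inv, Real.norm_eq_abs, abs_of_nonneg (cylRadius_nonneg x)]
      have : ‖(toLp 2 ![x 0, x 1, 0] : ℝ³)‖ = cylRadius x := by
        rw [cylRadius, EuclideanSpace.norm_eq, Fin.sum_univ_three]
        simp [Real.norm_eq_abs, sq_abs]
      rw [this, inv_mul_cancel₀ hx]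
  have hDF_le : ∀ x ∈ tsupport φ, |fderiv ℝ F x (eR x)| ≤ CDF := fun x hx => by
    rw [← Real.norm_eq_abs]
    exact ((fderiv ℝ F x).le_opNorm _).trans
      ((mul_le_of_le_one_right (norm_nonneg _) (heR x)).trans (hCDF x hx))
  have hDφ_le : ∀ x, |fderiv ℝ φ x (eR x)| ≤ CDφ := fun x => by
    rw [← Real.norm_eq_abs]
    exact ((fderiv ℝ φ x).le_opNorm _).trans
      ((mul_le_of_le_one_right (norm_nonneg _) (heR x)).trans (hCDφ x))
  -- the two integrands
  set G₁ : ℝ³ → ℝ := fun x => 2 / cylRadius x * (fderiv ℝ F x (eR x) * φ x) with hG₁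
  set G₂ : ℝ³ → ℝ := fun x => 2 / cylRadius x * (F x * fderiv ℝ φ x (eR x)) with hG₂
  -- measurability
  have hmeR : Measurable eR := by
    have h1 : Measurable fun x : ℝ³ => (cylRadius x)⁻¹ := continuous_cylRadius.measurable.inv
    have h2 : Continuous fun x : ℝ³ => (toLp 2 ![x 0, x 1, 0] : ℝ³) := by fun_prop
    exact h1.smul h2.measurable
  have happly : Measurable fun p : (ℝ³ →L[ℝ] ℝ) × ℝ³ => p.1 p.2 :=
    (isBoundedBilinearMap_apply (𝕜 := ℝ) (E := ℝ³) (F := ℝ)).continuous.measurable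
  have hmDF : Measurable fun x => fderiv ℝ F x (eR x) :=
    happly.comp ((hF.continuous_fderiv one_ne_zero).measurable.prodMk hmeR)
  have hmDφ : Measurable fun x => fderiv ℝ φ x (eR x) :=
    happly.comp ((hφ.continuous_fderiv one_ne_zero).measurable.prodMk hmeR)
  have hm2r : Measurable fun x : ℝ³ => 2 / cylRadius x :=
    measurable_const.div continuous_cylRadius.measurable
  have hmG₁ : AEStronglyMeasurable G₁ volume :=
    (hm2r.mul (hmDF.mul hφ.continuous.measurable)).aestronglyMeasurable
  have hmG₂ : AEStronglyMeasurable G₂ volume :=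
    (hm2r.mul (hF.continuous.measurable.mul hmDφ)).aestronglyMeasurable
  -- domination by `C · 1_box · r⁻¹`
  set C : ℝ := 2 * (CDF * Cφ + CF * CDφ) with hC
  have hCnn : 0 ≤ C := by positivity
  have hdom := ((integrableOn_inv_cylRadius_solidCylinder R R).integrable_indicator
    (measurableSet_solidCylinder R R)).const_mul C
  have hsupp : ∀ x, x ∉ tsupport φ → φ x = 0 ∧ fderiv ℝ φ x = 0 := fun x hx =>
    ⟨image_eq_zero_of_notMem_tsupport hx, fderiv_of_notMem_tsupport ℝ hx⟩
  have hind0 : ∀ x, 0 ≤ (solidCylinder R R).indicator (fun x => (cylRadius x)⁻¹) x := fun x =>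
    indicator_nonneg (fun y _ => inv_nonneg.2 (cylRadius_nonneg y)) x
  have hbound : ∀ {a b : ℝ} (x : ℝ³), |a| * |b| ≤ CDF * Cφ + CF * CDφ →
      (x ∉ tsupport φ → a * b = 0) →
      ‖2 / cylRadius x * (a * b)‖ ≤ C * (solidCylinder R R).indicator (fun x => (cylRadius x)⁻¹) x := by
    intro a b x hab hzero
    rw [Real.norm_eq_abs]
    by_cases hx : x ∈ tsupport φ
    · rw [indicator_of_mem (hK hx), abs_mul, abs_div, abs_two,
        abs_of_nonneg (cylRadius_nonneg x), abs_mul, div_eq_mul_inv, hC]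
      have hr : 0 ≤ (cylRadius x)⁻¹ := inv_nonneg.2 (cylRadius_nonneg x)
      nlinarith
    · rw [hzero hx, mul_zero, abs_zero]
      exact mul_nonneg hCnn (hind0 x)
  have hbound₁ : ∀ x, ‖G₁ x‖ ≤ C * (solidCylinder R R).indicator (fun x => (cylRadius x)⁻¹) x := by
    intro x
    refine hbound x ?_ fun hx => by rw [(hsupp x hx).1, mul_zero]
    by_cases hx : x ∈ tsupport φ
    · nlinarith [hDF_le x hx, hCφ x, abs_nonneg (fderiv ℝ F x (eR x)), abs_nonneg (φ x),
        mul_nonneg hCF0 hCDφ0]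
    · rw [(hsupp x hx).1, abs_zero, mul_zero]
      positivity
  have hbound₂ : ∀ x, ‖G₂ x‖ ≤ C * (solidCylinder R R).indicator (fun x => (cylRadius x)⁻¹) x := by
    intro x
    refine hbound x ?_ fun hx => by
      rw [(hsupp x hx).2, zero_apply, mul_zero]
    by_cases hx : x ∈ tsupport φ
    · nlinarith [hCF x hx, hDφ_le x, abs_nonneg (fderiv ℝ φ x (eR x)), abs_nonneg (F x),
        mul_nonneg hCDF0 hCφ0]
    · rw [(hsupp x hx).2, zero_apply, abs_zero, mul_zero]
      positivity
  have hint₁ : Integrable G₁ := hdom.mono' hmG₁ (Eventually.of_forall hbound₁)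
  have hint₂ : Integrable G₂ := hdom.mono' hmG₂ (Eventually.of_forall hbound₂)
  -- the sum is the axisymmetric scalar `(2/r) ∂ᵣ(Fφ)`; its integral vanishes
  have hsum_axi : IsAxisymmetricScalar fun x => G₁ x + G₂ x := by
    have h1 := hFa.fderiv_apply_eR hFd
    have h2 := hφa.fderiv_apply_eR hφd
    intro θ x
    simp only [hG₁, hG₂, cylRadius_rotZ, h1 θ x, h2 θ x, hFa θ x, hφa θ x]
  have hsum_zero : ∫ x, (G₁ x + G₂ x) = 0 := by
    rw [hsum_axi.integral_eq (hint₁.add hint₂)]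
    refine integral_eq_zero_of_ae (Eventually.of_forall fun z => ?_)
    -- on the slice `z`: `∫₀^∞ ρ (G₁ + G₂)(ρ,0,z) dρ = ∫₀^∞ 2 (Fφ)'(ρ) dρ = 0`
    simp only [Pi.zero_apply]
    set P : ℝ → ℝ := fun ρ => F (meridianPoint (ρ, z)) * φ (meridianPoint (ρ, z)) with hP
    set P' : ℝ → ℝ := fun ρ => fderiv ℝ F (meridianPoint (ρ, z)) (EuclideanSpace.single 0 1) *
      φ (meridianPoint (ρ, z)) + F (meridianPoint (ρ, z)) * fderiv ℝ φ (meridianPoint (ρ, z)) (EuclideanSpace.single 0 1)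
      with hP'
    have hPd : ∀ ρ, HasDerivAt P (P' ρ) ρ := fun ρ =>
      (hasDerivAt_comp_meridianPoint_fst z (hFd _)).mul (hasDerivAt_comp_meridianPoint_fst z (hφd _))
    have heq : EqOn (fun ρ => ρ • (G₁ (meridianPoint (ρ, z)) + G₂ (meridianPoint (ρ, z)))) (fun ρ => 2 * P' ρ)
        (Ioi 0) := by
      intro ρ hρ
      have hρ' : (0 : ℝ) < ρ := hρ
      simp only [hG₁, hG₂, hP', smul_eq_mul, cylRadius_meridianPoint_eq_abs, abs_of_pos hρ', eR_meridianPoint hρ']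
      field_simp
    rw [setIntegral_congr_fun measurableSet_Ioi heq, integral_const_mul]
    -- `P'` vanishes off `[-R-1, R+1]`, `P → 0`, and `P 0 = 0`
    have hout : ∀ ρ, R < |ρ| → meridianPoint (ρ, z) ∉ tsupport φ := by
      intro ρ hρ hmem
      have h1 := hK hmem
      simp only [solidCylinder, mem_setOf_eq, cylRadius_meridianPoint_eq_abs] at h1
      linarith [h1.1]
    have hP'zero : ∀ ρ, R < |ρ| → P' ρ = 0 := fun ρ hρ => by
      simp only [hP', (hsupp _ (hout ρ hρ)).1, (hsupp _ (hout ρ hρ)).2,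
        zero_apply, mul_zero, zero_add]
    have hc : Continuous fun ρ : ℝ => meridianPoint (ρ, z) :=
      continuous_iff_continuousAt.2 fun ρ => (hasDerivAt_meridianPoint_fst ρ z).continuousAt
    have hP'c : Continuous P' := by
      have h1 : Continuous fun ρ => fderiv ℝ F (meridianPoint (ρ, z)) (EuclideanSpace.single 0 1) :=
        ((hF.continuous_fderiv one_ne_zero).comp hc).clm_apply continuous_const
      have h2 : Continuous fun ρ => fderiv ℝ φ (meridianPoint (ρ, z)) (EuclideanSpace.single 0 1) :=
        ((hφ.continuous_fderiv one_ne_zero).comp hc).clm_apply continuous_const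
      simp only [hP']
      exact (h1.mul (hφ.continuous.comp hc)).add ((hF.continuous.comp hc).mul h2)
    have hP'int : IntegrableOn P' (Ioi 0) := by
      refine (Continuous.integrable_of_hasCompactSupport hP'c ?_).integrableOn
      refine HasCompactSupport.intro (isCompact_Icc (a := -(R + 1)) (b := R + 1)) fun ρ hρ => ?_
      apply hP'zero
      simp only [mem_Icc, not_and_or, not_le] at hρ
      rcases hρ with hρ | hρ
      · linarith [neg_le_abs ρ]
      · linarith [le_abs_self ρ]
    have hPlim : Tendsto P atTop (𝓝 0) := by
      apply tendsto_const_nhds.congr'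
      filter_upwards [eventually_gt_atTop |R|] with ρ hρ
      have hρ' : R < |ρ| := (le_abs_self R).trans_lt (hρ.trans_le (le_abs_self ρ))
      simp only [hP, (hsupp _ (hout ρ hρ')).1, mul_zero]
    have hP0 : P 0 = 0 := by
      simp only [hP]
      rw [hF0 _ (by rw [cylRadius_meridianPoint_eq_abs, abs_zero]), zero_mul]
    rw [integral_Ioi_of_hasDerivAt_of_tendsto' (fun ρ _ => hPd ρ) hP'int hPlim, hP0]
    simp
  -- conclude
  rw [integral_add hint₁ hint₂] at hsum_zero
  have h1 : (∫ x, G₁ x) = -∫ x, G₂ x := by linarith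
  exact ⟨hint₁, hint₂, h1⟩

/-- **Integration by parts in `r` against the weight `1/r`** (equality of integrals; KNSS 2009,
(5.19)–(5.20)): `∫ (2/r) ∂ᵣF φ dx = −∫ (2/r) F ∂ᵣφ dx` for axisymmetric `C¹` scalars with `φ`
compactly supported and `F = 0` on the axis. Both integrands are integrable
(`integrable_and_integral_two_div_cylRadius_mul_fderiv_eR`). [cite: KochNadirashviliSereginSverak2009, proof of Thm 5.3, (5.19)–(5.20) (arXiv p. 10)] -/
theorem integral_two_div_cylRadius_mul_fderiv_eR {F φ : ℝ³ → ℝ} (hF : ContDiff ℝ 1 F)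
    (hφ : ContDiff ℝ 1 φ) (hφc : HasCompactSupport φ) (hFa : IsAxisymmetricScalar F)
    (hφa : IsAxisymmetricScalar φ) (hF0 : ∀ x, cylRadius x = 0 → F x = 0) :
    ∫ x, 2 / cylRadius x * (fderiv ℝ F x (eR x) * φ x) =
      -∫ x, 2 / cylRadius x * (F x * fderiv ℝ φ x (eR x)) :=
  (integrable_and_integral_two_div_cylRadius_mul_fderiv_eR hF hφ hφc hFa hφa hF0).2.2

/-- The integrand `(2/r) ∂ᵣF φ` of the axis integration by parts is integrable. [folklore] -/
theorem integrable_two_div_cylRadius_mul_fderiv_eR_mul {F φ : ℝ³ → ℝ} (hF : ContDiff ℝ 1 F)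
    (hφ : ContDiff ℝ 1 φ) (hφc : HasCompactSupport φ) (hFa : IsAxisymmetricScalar F)
    (hφa : IsAxisymmetricScalar φ) (hF0 : ∀ x, cylRadius x = 0 → F x = 0) :
    Integrable (fun x => 2 / cylRadius x * (fderiv ℝ F x (eR x) * φ x)) :=
  (integrable_and_integral_two_div_cylRadius_mul_fderiv_eR hF hφ hφc hFa hφa hF0).1

/-- The integrand `(2/r) F ∂ᵣφ` of the axis integration by parts is integrable. [folklore] -/
theorem integrable_two_div_cylRadius_mul_mul_fderiv_eR {F φ : ℝ³ → ℝ} (hF : ContDiff ℝ 1 F)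
    (hφ : ContDiff ℝ 1 φ) (hφc : HasCompactSupport φ) (hFa : IsAxisymmetricScalar F)
    (hφa : IsAxisymmetricScalar φ) (hF0 : ∀ x, cylRadius x = 0 → F x = 0) :
    Integrable (fun x => 2 / cylRadius x * (F x * fderiv ℝ φ x (eR x))) :=
  (integrable_and_integral_two_div_cylRadius_mul_fderiv_eR hF hφ hφc hFa hφa hF0).2.1

end AxisIBP

end Literature.Analysis.FluidPDE

end
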